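import Mathlib.Analysis.SpecialFunctions.Pow.Deriv
import Mathlib.Analysis.InnerProductSpace.Calculus
import Literature.Barriers.AtomisticToContinuum.ShockFormationPointwise
import Literature.Analysis.FluidPDE.SpaceTimeCalculusC1
import Literature.Analysis.FluidPDE.WholeSpaceIBP
import HarnessLib

/-!
# Sideris 1985, Theorem 1 — the pointwise energy identity of the symmetrised polytropic
# Euler system

Support file 2 for the discharge of
`Literature.Barriers.AtomisticToContinuum.ShockFormationBarrier` (Sideris, Comm. Math. Phys.
101 (1985), Thm. 1): the differential identity behind the local energy estimate proving
Sideris' Proposition (finite propagation speed, §1 p. 476).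

For a `C¹` solution `(ρ, u, S)` of (1.1 a–d) (`IsPolytropicC1Solution A γ (Ici 0) ρ u S`) with
pressure `p = A ρ^γ e^S`, and the energy density `e` and flux multiplier `e + 2 (p - p̄)` of
`ShockFormationPointwise` relative to a rest state `(ρ̄, 0, S̄)`, we prove at every `t > 0`, `x`:

`∂ₜ e + div ((e + 2 (p - p̄)) u) = (div u) · ((γ + 1) (p - p̄)² / (γ p) + (S - S̄)²)`

(`IsPolytropicC1Solution.hasDerivAt_energyDensity`), from the chain rule along time lines and
space lines (`hasDerivAt_polytropicPressure_comp`, `hasDerivAt_energyDensity_comp`), the derived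
pressure equation `∂ₜp + u·∇p = -γ p div u`, and the three equations (1.1 a–c). Also: joint
`C¹` regularity of the pressure, energy and flux fields of a solution.

## Mathlib search

Chain rules `HasDerivAt.rpow_const`, `HasDerivAt.exp`, `HasDerivAt.norm_sq`, `HasDerivAt.inner`,
uniqueness `HasDerivAt.unique`, and the tree's `divergence_smul_apply` (`WholeSpaceIBP`) and
`C¹` space–time dictionary (`SpaceTimeCalculusC1`). No definitions in this file.

## References

* T. C. Sideris, Comm. Math. Phys. 101 (1985) 475–485, §1 (1.1 a–d), Proposition p. 476.
* T. C. Sideris, Arch. Rational Mech. Anal. 86 (1984) 369–381 (local energy estimates).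
* F. John, *Partial Differential Equations*, 4th ed. (1982), Ch. 5 §3.
-/

noncomputable section

open Set Function Filter MeasureTheory
open scoped RealInnerProductSpace Topology

namespace Literature.Barriers.AtomisticToContinuum.PolytropicEuler

open Literature.Analysis.FluidPDE Literature.Analysis.FluidPDE.VectorCalculus

/-! ### Chain rules along curves for the pressure and the energy density -/

/-- **Pressure along a curve**: if `r, s` have derivatives `r', s'` at `τ` and `r τ > 0`, then
`σ ↦ p(r σ, s σ) = A (r σ)^γ e^{s σ}` has derivative `(γ p / r) r' + p s'` at `τ`
(`dp = (γ p/ρ) dρ + p dS`, Sideris (1.1d)). [cite: Sideris1985, (1.1d)] -/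
theorem hasDerivAt_polytropicPressure_comp (A γ : ℝ) {r s : ℝ → ℝ} {r' s' τ : ℝ}
    (hr : HasDerivAt r r' τ) (hs : HasDerivAt s s' τ) (hr0 : 0 < r τ) :
    HasDerivAt (fun σ => polytropicPressure A γ (r σ) (s σ))
      (γ * polytropicPressure A γ (r τ) (s τ) / r τ * r' +
        polytropicPressure A γ (r τ) (s τ) * s') τ := by
  unfold polytropicPressure
  have h1 := ((hr.rpow_const (p := γ) (Or.inl hr0.ne')).const_mul A).mul hs.exp
  refine h1.congr_deriv ?_
  rw [Real.rpow_sub_one hr0.ne']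
  field_simp

/-- **Energy density along a curve** (chain rule): for curves `r, v, s` with derivatives
`r', v', s'` at `τ`, `r τ > 0`, the composite `σ ↦ e(r σ, v σ, s σ)` has derivative
`G'(p) ṗ + (r' ‖v‖² + 2 r ⟪v, v'⟫) + 2 (s - S̄) s'` with `G(p) = (p - p̄)²/(γ p)`,
`G'(p) = 2(p - p̄)/(γ p) - (p - p̄)²/(γ p²)` and `ṗ = (γ p / r) r' + p s'`. [folklore] -/
theorem hasDerivAt_energyDensity_comp (A γ ρbar Sbar : ℝ) (hA : 0 < A) (hγ : γ ≠ 0)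
    {r s : ℝ → ℝ} {v : ℝ → E3} {r' s' τ : ℝ} {v' : E3}
    (hr : HasDerivAt r r' τ) (hv : HasDerivAt v v' τ) (hs : HasDerivAt s s' τ) (hr0 : 0 < r τ) :
    HasDerivAt (fun σ => energyDensity A γ ρbar Sbar (r σ) (v σ) (s σ))
      ((2 * (polytropicPressure A γ (r τ) (s τ) - polytropicPressure A γ ρbar Sbar) /
            (γ * polytropicPressure A γ (r τ) (s τ)) -
          (polytropicPressure A γ (r τ) (s τ) - polytropicPressure A γ ρbar Sbar) ^ 2 /
            (γ * polytropicPressure A γ (r τ) (s τ) ^ 2)) *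
          (γ * polytropicPressure A γ (r τ) (s τ) / r τ * r' +
            polytropicPressure A γ (r τ) (s τ) * s') +
        (r' * ‖v τ‖ ^ 2 + r τ * (2 * ⟪v τ, v'⟫)) + 2 * (s τ - Sbar) * s') τ := by
  have hP := hasDerivAt_polytropicPressure_comp A γ hr hs hr0
  have hP0 : 0 < polytropicPressure A γ (r τ) (s τ) := polytropicPressure_pos hA hr0
  have hγP : γ * polytropicPressure A γ (r τ) (s τ) ≠ 0 := mul_ne_zero hγ hP0.ne'
  -- the acoustic term `G(p(σ)) = (p - p̄)² / (γ p)`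
  have hG := ((hP.sub_const (polytropicPressure A γ ρbar Sbar)).mul
    (hP.sub_const (polytropicPressure A γ ρbar Sbar))).div (hP.const_mul γ) hγP
  -- the kinetic and entropy terms
  have hK := hr.mul hv.norm_sq
  have hE := (hs.sub_const Sbar).mul (hs.sub_const Sbar)
  have hsum := (hG.add hK).add hE
  have hfun : (fun σ => energyDensity A γ ρbar Sbar (r σ) (v σ) (s σ)) = fun σ =>
      (polytropicPressure A γ (r σ) (s σ) - polytropicPressure A γ ρbar Sbar) *
            (polytropicPressure A γ (r σ) (s σ) - polytropicPressure A γ ρbar Sbar) /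
          (γ * polytropicPressure A γ (r σ) (s σ)) +
        r σ * ‖v σ‖ ^ 2 + (s σ - Sbar) * (s σ - Sbar) := by
    funext σ
    simp only [energyDensity]
    ring
  rw [hfun]
  refine hsum.congr_deriv ?_
  simp only [Pi.mul_apply]
  field_simp
  ring

/-! ### Regularity of the pressure, energy and flux fields of a `C¹` solution -/

section Regularity

variable {A γ : ℝ} {ρ : ℝ → E3 → ℝ} {u : ℝ → E3 → E3} {S : ℝ → E3 → ℝ}

/-- The pressure field `(t, x) ↦ p(ρ, S)(t, x)` of a `C¹` solution is jointly `C¹` on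
`[0, ∞) × ℝ³` (`ρ > 0`). [cite: Sideris1985, (1.1d)] -/
theorem _root_.Literature.Barriers.AtomisticToContinuum.IsPolytropicC1Solution.contDiffOn_pressure
    (h : IsPolytropicC1Solution A γ (Ici 0) ρ u S) :
    ContDiffOn ℝ 1 (uncurry fun t x => polytropicPressure A γ (ρ t x) (S t x)) (Ici 0 ×ˢ univ) := by
  unfold polytropicPressure
  have hρ := h.contDiffOn_density
  have hS := h.contDiffOn_entropy
  have hne : ∀ p ∈ Ici (0 : ℝ) ×ˢ (univ : Set E3), (fun q : ℝ × E3 => ρ q.1 q.2) p ≠ 0 :=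
    fun p hp => (h.density_pos p.1 (mem_prod.1 hp).1 p.2).ne'
  exact ((contDiffOn_const.mul (hρ.rpow_const_of_ne hne)).mul hS.exp)

/-- The energy density field of a `C¹` solution is jointly `C¹` on `[0, ∞) × ℝ³`. [folklore] -/
theorem _root_.Literature.Barriers.AtomisticToContinuum.IsPolytropicC1Solution.contDiffOn_energyDensity
    (h : IsPolytropicC1Solution A γ (Ici 0) ρ u S) (hA : 0 < A) (hγ : γ ≠ 0) (ρbar Sbar : ℝ) :
    ContDiffOn ℝ 1 (uncurry fun t x => energyDensity A γ ρbar Sbar (ρ t x) (u t x) (S t x))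
      (Ici 0 ×ˢ univ) := by
  have hP := h.contDiffOn_pressure
  have hρ := h.contDiffOn_density
  have hu := h.contDiffOn_velocity
  have hS := h.contDiffOn_entropy
  have hne : ∀ p ∈ Ici (0 : ℝ) ×ˢ (univ : Set E3),
      γ * polytropicPressure A γ (ρ p.1 p.2) (S p.1 p.2) ≠ 0 := fun p hp =>
    mul_ne_zero hγ (polytropicPressure_pos hA (h.density_pos p.1 (mem_prod.1 hp).1 p.2)).ne'
  unfold energyDensity
  exact ((((hP.sub contDiffOn_const).pow 2).div (contDiffOn_const.mul hP) hne).add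
    (hρ.mul (hu.norm_sq ℝ))).add ((hS.sub contDiffOn_const).pow 2)

/-- The flux multiplier field `e + 2 (p - p̄)` of a `C¹` solution is jointly `C¹` on
`[0, ∞) × ℝ³`. [folklore] -/
theorem _root_.Literature.Barriers.AtomisticToContinuum.IsPolytropicC1Solution.contDiffOn_energyFluxFactor
    (h : IsPolytropicC1Solution A γ (Ici 0) ρ u S) (hA : 0 < A) (hγ : γ ≠ 0) (ρbar Sbar : ℝ) :
    ContDiffOn ℝ 1 (uncurry fun t x => energyFluxFactor A γ ρbar Sbar (ρ t x) (u t x) (S t x))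
      (Ici 0 ×ˢ univ) := by
  unfold energyFluxFactor
  exact (h.contDiffOn_energyDensity hA hγ ρbar Sbar).add
    (contDiffOn_const.mul (h.contDiffOn_pressure.sub contDiffOn_const))

end Regularity

/-! ### The pointwise energy identity -/

/-- **The algebra of the energy identity.** With the scalar unknowns at a point — `P, p̄, r`
(pressure, rest pressure, density), `nv2 = ‖u‖²`, `δ = div u`, `a = Dρ(u)`, `c = DS(u)`,
`m = ⟪u, Du(u)⟫`, `n = ⟪u, ∂ₜu⟫`, `rt = ∂ₜρ`, `st = ∂ₜS` — the three equations (1.1 a–c)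
(mass `rt + (r δ + a) = 0`, entropy `st + c = 0`, momentum paired with `u`:
`r (n + m) + Dp(u) = 0`, `Dp = (γP/r) Dρ + P DS`) turn the chain-rule expression for `∂ₜe` into
`-(div ((e + 2(p - p̄)) u)) + δ ((γ+1)(p - p̄)²/(γp) + (S - S̄)²)`. [folklore] -/
theorem energyIdentity_algebra {γ P pbar r nv2 δ a c m n rt st s Sbar : ℝ} (hγ : γ ≠ 0)
    (hP : P ≠ 0) (hr : r ≠ 0) (hmass : rt + (r * δ + a) = 0) (hent : st + c = 0)
    (hmom : r * (n + m) + (γ * P / r * a + P * c) = 0) :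
    (2 * (P - pbar) / (γ * P) - (P - pbar) ^ 2 / (γ * P ^ 2)) * (γ * P / r * rt + P * st) +
          (rt * nv2 + r * (2 * n)) + 2 * (s - Sbar) * st =
      -(((P - pbar) ^ 2 / (γ * P) + r * nv2 + (s - Sbar) ^ 2 + 2 * (P - pbar)) * δ +
            ((2 * (P - pbar) / (γ * P) - (P - pbar) ^ 2 / (γ * P ^ 2)) *
                    (γ * P / r * a + P * c) +
                  (a * nv2 + r * (2 * m)) + 2 * (s - Sbar) * c +
              2 * (γ * P / r * a + P * c))) +
        δ * ((γ + 1) * (P - pbar) ^ 2 / (γ * P) + (s - Sbar) ^ 2) := by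
  have hrt : rt = -(r * δ + a) := by linarith
  have hst : st = -c := by linarith
  have hn : n = -m - (γ * P / r * a + P * c) / r := by
    field_simp
    field_simp at hmom
    linarith
  subst hrt hst hn
  field_simp
  ring

section Identity

variable {A γ : ℝ} {ρ : ℝ → E3 → ℝ} {u : ℝ → E3 → E3} {S : ℝ → E3 → ℝ}

/-- **The pointwise energy identity of the symmetrised system.** For a `C¹` solution of
(1.1 a–d) and any rest state `(ρ̄, 0, S̄)`, at every `t > 0` and `x`, the time line of the energy
density `e = (p - p̄)²/(γp) + ρ‖u‖² + (S - S̄)²` has derivative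
`∂ₜe = -div ((e + 2 (p - p̄)) u) + (div u) ((γ + 1)(p - p̄)²/(γ p) + (S - S̄)²)`
— the local form `∂ₜ(Vᵀ A⁰ V) + ∑ⱼ ∂ⱼ(Vᵀ Aʲ V) = Vᵀ (∂ₜA⁰ + ∑ⱼ ∂ⱼAʲ) V` of the energy identity
for the symmetric hyperbolic system in `V = (p - p̄, u, S - S̄)`, which is the identity
integrated over backward cones in the local energy estimate (Sideris 1984, Proposition). [folklore] -/
theorem _root_.Literature.Barriers.AtomisticToContinuum.IsPolytropicC1Solution.hasDerivAt_energyDensity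
    (h : IsPolytropicC1Solution A γ (Ici 0) ρ u S) (hA : 0 < A) (hγ : 0 < γ) (ρbar Sbar : ℝ)
    {t : ℝ} (ht : 0 < t) (x : E3) :
    HasDerivAt (fun s => energyDensity A γ ρbar Sbar (ρ s x) (u s x) (S s x))
      (-divergence (fun y => energyFluxFactor A γ ρbar Sbar (ρ t y) (u t y) (S t y) • u t y) x +
        divergence (u t) x *
          ((γ + 1) * (polytropicPressure A γ (ρ t x) (S t x) - polytropicPressure A γ ρbar Sbar) ^ 2 /
              (γ * polytropicPressure A γ (ρ t x) (S t x)) + (S t x - Sbar) ^ 2)) t := by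
  have hIci : Ici (0 : ℝ) ∈ 𝓝 t := Ici_mem_nhds ht
  have ht' : t ∈ Ici (0 : ℝ) := ht.le
  have hr0 : 0 < ρ t x := h.density_pos t ht' x
  have hP0 : 0 < polytropicPressure A γ (ρ t x) (S t x) := polytropicPressure_pos hA hr0
  -- time derivatives of the three fields at `(t, x)`
  have hρt : HasDerivAt (fun s => ρ s x) (timeDerivWithin (Ici 0) ρ t x) t :=
    hasDerivAt_timeLine_timeDerivWithin h.contDiffOn_density hIci x
  have hut : HasDerivAt (fun s => u s x) (timeDerivWithin (Ici 0) u t x) t :=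
    hasDerivAt_timeLine_timeDerivWithin h.contDiffOn_velocity hIci x
  have hSt : HasDerivAt (fun s => S s x) (timeDerivWithin (Ici 0) S t x) t :=
    hasDerivAt_timeLine_timeDerivWithin h.contDiffOn_entropy hIci x
  -- the chain rule along the time line
  have he_t := hasDerivAt_energyDensity_comp A γ ρbar Sbar hA hγ.ne' hρt hut hSt hr0
  refine he_t.congr_deriv ?_
  -- slices are `C¹`
  have hρs : ContDiff ℝ 1 (ρ t) := contDiff_slice_of_contDiffOn h.contDiffOn_density ht'
  have hus : ContDiff ℝ 1 (u t) := contDiff_slice_of_contDiffOn h.contDiffOn_velocity ht'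
  have hSs : ContDiff ℝ 1 (S t) := contDiff_slice_of_contDiffOn h.contDiffOn_entropy ht'
  have hρd : ∀ y, DifferentiableAt ℝ (ρ t) y := fun y => hρs.differentiable one_ne_zero y
  have hud : ∀ y, DifferentiableAt ℝ (u t) y := fun y => hus.differentiable one_ne_zero y
  have hSd : ∀ y, DifferentiableAt ℝ (S t) y := fun y => hSs.differentiable one_ne_zero y
  -- the pressure, energy and flux slices
  set Ps : E3 → ℝ := fun y => polytropicPressure A γ (ρ t y) (S t y) with hPs_def
  set es : E3 → ℝ := fun y => energyDensity A γ ρbar Sbar (ρ t y) (u t y) (S t y) with hes_def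
  set gs : E3 → ℝ := fun y => energyFluxFactor A γ ρbar Sbar (ρ t y) (u t y) (S t y) with hgs_def
  have hPss : ContDiff ℝ 1 Ps :=
    contDiff_slice_of_contDiffOn (w := fun s y => polytropicPressure A γ (ρ s y) (S s y))
      h.contDiffOn_pressure ht'
  have hess : ContDiff ℝ 1 es :=
    contDiff_slice_of_contDiffOn (w := fun s y => energyDensity A γ ρbar Sbar (ρ s y) (u s y) (S s y))
      (h.contDiffOn_energyDensity hA hγ.ne' ρbar Sbar) ht'
  have hgss : ContDiff ℝ 1 gs :=
    contDiff_slice_of_contDiffOn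
      (w := fun s y => energyFluxFactor A γ ρbar Sbar (ρ s y) (u s y) (S s y))
      (h.contDiffOn_energyFluxFactor hA hγ.ne' ρbar Sbar) ht'
  have hPsd : ∀ y, DifferentiableAt ℝ Ps y := fun y => hPss.differentiable one_ne_zero y
  have hesd : ∀ y, DifferentiableAt ℝ es y := fun y => hess.differentiable one_ne_zero y
  have hgsd : ∀ y, DifferentiableAt ℝ gs y := fun y => hgss.differentiable one_ne_zero y
  -- the streamline through `x`: `τ ↦ x + τ • v`, `v = u t x`
  set v : E3 := u t x with hv_def
  have hx0 : x + (0 : ℝ) • v = x := by simp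
  have hline : HasDerivAt (fun τ : ℝ => x + τ • v) v 0 := by
    simpa using ((hasDerivAt_id (0 : ℝ)).smul_const v).const_add x
  have comp_line : ∀ {f : E3 → ℝ}, DifferentiableAt ℝ f x →
      HasDerivAt (fun τ : ℝ => f (x + τ • v)) (fderiv ℝ f x v) 0 := fun {f} hf => by
    have hf0 : HasFDerivAt f (fderiv ℝ f x) (x + (0 : ℝ) • v) := by rw [hx0]; exact hf.hasFDerivAt
    exact hf0.comp_hasDerivAt (0 : ℝ) hline
  have comp_line' : ∀ {f : E3 → E3}, DifferentiableAt ℝ f x →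
      HasDerivAt (fun τ : ℝ => f (x + τ • v)) (fderiv ℝ f x v) 0 := fun {f} hf => by
    have hf0 : HasFDerivAt f (fderiv ℝ f x) (x + (0 : ℝ) • v) := by rw [hx0]; exact hf.hasFDerivAt
    exact hf0.comp_hasDerivAt (0 : ℝ) hline
  -- the chain rule along the streamline, for `p` and `e`
  have hρl := comp_line (hρd x)
  have hul := comp_line' (hud x)
  have hSl := comp_line (hSd x)
  have hr0' : 0 < ρ t (x + (0 : ℝ) • v) := by rw [hx0]; exact hr0
  have hP_x := hasDerivAt_polytropicPressure_comp A γ hρl hSl hr0'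
  have he_x := hasDerivAt_energyDensity_comp A γ ρbar Sbar hA hγ.ne' hρl hul hSl hr0'
  simp only [hx0] at hP_x he_x
  -- identify the directional derivatives `Dp(v)`, `De(v)` by uniqueness
  have hDP : fderiv ℝ Ps x v = γ * polytropicPressure A γ (ρ t x) (S t x) / ρ t x *
      fderiv ℝ (ρ t) x v + polytropicPressure A γ (ρ t x) (S t x) * fderiv ℝ (S t) x v :=
    (comp_line (hPsd x)).unique hP_x
  have hDe := (comp_line (hesd x)).unique he_x
  -- `Dg = De + 2 Dp`
  have hDg : fderiv ℝ gs x v = fderiv ℝ es x v + 2 * fderiv ℝ Ps x v := by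
    have h1 : HasFDerivAt gs (fderiv ℝ es x + (2 : ℝ) • fderiv ℝ Ps x) x :=
      (hesd x).hasFDerivAt.add (((hPsd x).hasFDerivAt.sub_const
        (polytropicPressure A γ ρbar Sbar)).const_mul (2 : ℝ))
    rw [h1.fderiv]
    simp
  -- the divergence of the flux `g • u`
  have hdiv : divergence (fun y => gs y • u t y) x =
      gs x * divergence (u t) x + fderiv ℝ gs x v := by
    rw [divergence_smul_apply (hgsd x) (hud x), gradient, real_inner_comm,
      InnerProductSpace.toDual_symm_apply]
  -- the three equations at `(t, x)`
  have hmass : timeDerivWithin (Ici 0) ρ t x +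
      (ρ t x * divergence (u t) x + fderiv ℝ (ρ t) x v) = 0 := by
    have := h.mass t ht' x
    rwa [divergence_smul_apply (hρd x) (hud x), gradient, real_inner_comm,
      InnerProductSpace.toDual_symm_apply] at this
  have hent : timeDerivWithin (Ici 0) S t x + fderiv ℝ (S t) x v = 0 := by
    simpa [convect] using h.entropy t ht' x
  have hmom : ρ t x * (⟪v, timeDerivWithin (Ici 0) u t x⟫ + ⟪v, fderiv ℝ (u t) x v⟫) +
      (γ * polytropicPressure A γ (ρ t x) (S t x) / ρ t x * fderiv ℝ (ρ t) x v +
        polytropicPressure A γ (ρ t x) (S t x) * fderiv ℝ (S t) x v) = 0 := by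
    have h1 := congrArg (fun w => ⟪v, w⟫) (h.momentum t ht' x)
    have h2 : ⟪v, gradient (fun y => polytropicPressure A γ (ρ t y) (S t y)) x⟫ =
        γ * polytropicPressure A γ (ρ t x) (S t x) / ρ t x * fderiv ℝ (ρ t) x v +
          polytropicPressure A γ (ρ t x) (S t x) * fderiv ℝ (S t) x v := by
      rw [gradient, real_inner_comm, InnerProductSpace.toDual_symm_apply]
      exact hDP
    simp only [inner_add_right, inner_smul_right, inner_zero_right, convect, h2] at h1
    rw [← hv_def] at h1
    linarith [h1]
  -- assemble
  rw [hdiv, hDg, hDe, hDP]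
  have hgsx : gs x = (polytropicPressure A γ (ρ t x) (S t x) - polytropicPressure A γ ρbar Sbar) ^ 2 /
        (γ * polytropicPressure A γ (ρ t x) (S t x)) + ρ t x * ‖u t x‖ ^ 2 + (S t x - Sbar) ^ 2 +
      2 * (polytropicPressure A γ (ρ t x) (S t x) - polytropicPressure A γ ρbar Sbar) := rfl
  rw [hgsx]
  exact energyIdentity_algebra hγ.ne' hP0.ne' hr0.ne' hmass hent hmom

end Identity

end Literature.Barriers.AtomisticToContinuum.PolytropicEuler

end
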